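/-
Copyright (c) 2026. All rights reserved.
Released under Apache 2.0 license as described in the file LICENSE.
Authors: HodgeCM publication cell (pub-hodgecm), GR lane, seat GR-2 (`pub-hodgecm-own-hyp34`).
-/
import Literature.NumberTheory.GelbartRogawski1991.Prop311PrintedUnitaryFrame
import HarnessLib

/-!
# [GelbartRogawski1991, §3.1, Prop. 3.1.1]: the PRINTED `G(𝐀)` in an `E`-frame, II — the HOMEOMORPHISM
# `G(𝐀) ≃ₜ* U(J)(𝔸_F)` and the RATIONAL POINTS `G(F) ↔ U(J)(F)`

Topic `NumberTheory/GelbartRogawski1991`; namespace `Literature.NumberTheory.GelbartRogawski1991.Prop311`.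
Definitions and proved lemmas only; nothing of [GelbartRogawski1991] is asserted; `Prop311AsPrinted` is untouched.

Sequel of `Prop311PrintedUnitaryFrame` (`frameUnitary b : Prop311.adelicUnitary F E V Φ ≃* UnitaryGroup.adelic F E σ N J`,
`J = gramMatrix b Φ`, for an `E`-basis `b` of the printed skew-Hermitian space `(V, Φ)` of [GelbartRogawski1991, §3.1
p. 454 L37–38]).  Prop. 3.1.1 (p. 455 L1–2) asks for a CONTINUOUS section over `G(𝐀)` carrying `G(F)` into `i(Sp_F(W))`;
to move it between print's `G(𝐀)` (rendering R5/R8 of `Prop311AsPrinted`: pointwise convergence on `W_𝐀`) and the tree's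
matrix group `U(J)(𝔸_F) ≤ GL_N(𝔸_E)` (unit-group topology) one needs `frameUnitary b` to be a homeomorphism and to
respect rational points:

* §1 `Φ v v' = h_J([v'], [v])` (`apply_eq_hermForm`) and **`isUnit_det_gramMatrix`**: the Gram matrix of a `Φ` with
  `φ = Tr_{E/F} Φ` non-degenerate (the printed hypothesis "`(W, φ)` symplectic") is invertible;
* §2 on a unitary group with invertible form matrix the inverse is a polynomial: `[g]⁻¹ = J⁻¹ ᵗ(σ[g]) J`
  (`coe_inv_eq_of_mem_unitaryGroupOfForm`), hence **`continuous_frameUnitary`** (print → tree) and the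
  topological-group isomorphism **`frameUnitaryHomeomorph b : G(𝐀) ≃ₜ* U(J)(𝔸_F)`** (with `continuous_frameUnitary_symm`);
* §3 RATIONAL POINTS: `linearEquivOfGL b γ` (the `E`-automorphism of `V` with matrix `γ`), and
  **`frameUnitary_mem_range_toAdelic_iff`**: `[g]_b ∈ U(J)(F)` (the range of the tree's diagonal embedding
  `UnitaryGroup.toAdelic`) **iff** `IsRationalPoint g` (print's "`g ∈ G(F)`", `g = 1 ⊗ g₀`).

So, in an `E`-frame, the pair (print's `G(𝐀)`, "`g ∈ G(F)`") IS the pair (tree's `U(J)(𝔸_F)`, `toAdelic (U(J)(F))`) as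
topological groups with distinguished subgroups — the `GA`/`ratPts` entries of a `SplittingDatum`
(`CompatibleSplitting.lean`; transport: `CompatibleSplittingInvariance.lean`).

## References
* [GelbartRogawski1991] S. Gelbart, J. Rogawski, Invent. Math. 105 (1991) 445–472, §3.1 p. 454 L37–42, Prop. 3.1.1
  p. 455 L1–2.
* [Mok2014] C. P. Mok, Mem. AMS 235 (2015), §1 Notation p. 5 (`U(J)(F) ⊂ U(J)(𝔸_F)` as matrix groups).
-/

set_option autoImplicit false

noncomputable section

open NumberField
open scoped TensorProduct Matrix
open Literature.NumberTheory.Automorphic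
open Literature.NumberTheory.Automorphic.UnitaryGroup

namespace Literature.NumberTheory.GelbartRogawski1991

namespace Prop311

open QuadraticCoordinates

variable (F : Type) [Field F] [NumberField F]
variable (E : Type) [Field E] [NumberField E] [Algebra F E] [Algebra.IsQuadraticExtension F E]
variable (σ : E ≃ₐ[F] E) {δ : E} (hσδ : σ δ = -δ) (hδ : δ ≠ 0) {d : F} (hd : δ * δ = algebraMap F E d)
variable (V : Type) [AddCommGroup V] [Module F V] [Module E V] [IsScalarTower F E V]
variable {n : ℕ} (b : Module.Basis (Fin n) E V)
variable (Φ : V →ₗ[F] V →ₗ[F] E)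

/-! ## §1. `Φ` as the hermitian pairing of its Gram matrix; invertibility of the Gram matrix -/

section Gram

omit [NumberField F] [NumberField E] [Algebra.IsQuadraticExtension F E] [IsScalarTower F E V] in
/-- **`Φ v v' = h_J([v']_b, [v]_b)`** with `J = gramMatrix b Φ` and the tree's `hermForm σ J X Y = ᵗ(σ X) J Y`.
[cite: GelbartRogawski1991, §3.1 p. 454 L37–38] -/
theorem apply_eq_hermForm (hΦ₁ : ∀ (e : E) (x y : V), Φ (e • x) y = e * Φ x y)
    (hΦ₂ : ∀ (e : E) (x y : V), Φ x (e • y) = Φ x y * σ e) (v v' : V) :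
    Φ v v' = hermForm (σ : E →+* E) (gramMatrix F E V b Φ) (b.repr v') (b.repr v) := by
  rw [apply_eq_sum_repr F E σ V b Φ hΦ₁ hΦ₂, hermForm_apply]
  simp only [dotProduct, Matrix.mulVec, Function.comp_apply, gramMatrix_apply, Finset.mul_sum, RingHom.coe_coe]
  rw [Finset.sum_comm]
  exact Finset.sum_congr rfl fun i _ => Finset.sum_congr rfl fun j _ => by ring

omit [NumberField F] [NumberField E] [Algebra.IsQuadraticExtension F E] [IsScalarTower F E V] in
/-- **the Gram matrix is invertible** when `φ = Tr_{E/F}(Φ)` is non-degenerate ("`(W, φ)` … symplectic space",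
p. 454 L17, L40–41): a kernel vector of `J` gives a `v ≠ 0` with `Φ(v, ·) = 0`, hence `φ(v, ·) = 0`.
[cite: GelbartRogawski1991, §3.1 p. 454 L17, L37–42] -/
theorem isUnit_det_gramMatrix (hΦ₁ : ∀ (e : E) (x y : V), Φ (e • x) y = e * Φ x y)
    (hΦ₂ : ∀ (e : E) (x y : V), Φ x (e • y) = Φ x y * σ e) (hφ : (traceForm F E V Φ).Nondegenerate) :
    IsUnit (gramMatrix F E V b Φ).det := by
  rw [isUnit_iff_ne_zero]
  intro hdet
  obtain ⟨y, hy0, hy⟩ := Matrix.exists_mulVec_eq_zero_iff.2 hdet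
  have hrepr : (b.repr (b.equivFun.symm y) : Fin n → E) = y := by
    rw [← Module.Basis.equivFun_apply, LinearEquiv.apply_symm_apply]
  refine hy0 ?_
  have hv : b.equivFun.symm y = 0 := hφ.1 _ fun w => by
    rw [traceForm_apply, apply_eq_hermForm F E σ V b Φ hΦ₁ hΦ₂, hermForm_apply, hrepr, hy, dotProduct_zero, map_zero]
  rw [← hrepr, hv, map_zero, Finsupp.coe_zero]

end Gram

/-! ## §2. The homeomorphism `G(𝐀) ≃ₜ* U(J)(𝔸_F)` -/

section Topology

variable {S : Type*} [CommRing S] {m : Type*} [Fintype m] [DecidableEq m]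

/-- on a unitary group with INVERTIBLE form matrix the inverse is polynomial in the entries:
`g ∈ U(τ, H)`, `det H` a unit ⇒ `g⁻¹ = H⁻¹ ᵗ(τ g) H`. [cite: Mok2014, §1 Notation p. 5] -/
theorem coe_inv_eq_of_mem_unitaryGroupOfForm {τ : S →+* S} {H : Matrix m m S} (hH : IsUnit H.det) {g : GL m S}
    (hg : g ∈ unitaryGroupOfForm τ H) :
    ((g⁻¹ : GL m S) : Matrix m m S) = H⁻¹ * ((g : Matrix m m S).map τ)ᵀ * H := by
  rw [mem_unitaryGroupOfForm_iff] at hg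
  rw [Matrix.coe_units_inv]
  apply Matrix.inv_eq_left_inv
  calc H⁻¹ * ((g : Matrix m m S).map τ)ᵀ * H * (g : Matrix m m S)
      = H⁻¹ * (((g : Matrix m m S).map τ)ᵀ * H * (g : Matrix m m S)) := by simp only [Matrix.mul_assoc]
    _ = 1 := by rw [hg, Matrix.nonsing_inv_mul H hH]

/-- **`frameUnitary b : G(𝐀) → U(J)(𝔸_F)` is continuous** (printed topology of pointwise convergence on `W_𝐀` → the
unit-group topology of `GL_N(𝔸_E)`) when the Gram matrix is invertible: the entries of `[g]_b` are continuous
(`continuous_coe_frameUnitary`) and `[g]_b⁻¹ = J⁻¹ ᵗ(σ_𝔸 [g]_b) J`. [cite: GelbartRogawski1991, Prop. 3.1.1 p. 455 L1–2] -/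
theorem continuous_frameUnitary (hΦ₁ : ∀ (e : E) (x y : V), Φ (e • x) y = e * Φ x y)
    (hΦ₂ : ∀ (e : E) (x y : V), Φ x (e • y) = Φ x y * σ e) (hJ : IsUnit (gramMatrix F E V b Φ).det) :
    Continuous (frameUnitary F E σ hσδ hδ hd V b Φ hΦ₁ hΦ₂) := by
  have hJA : IsUnit ((gramMatrix F E V b Φ).map (algebraMap E (AdeleRing (𝓞 E) E))).det := by
    rw [← RingHom.mapMatrix_apply, ← RingHom.map_det]
    exact hJ.map _
  have hcoe := continuous_coe_frameUnitary F E σ hσδ hδ hd V b Φ hΦ₁ hΦ₂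
  refine continuous_induced_rng.2 (Units.continuous_iff.2 ⟨hcoe, ?_⟩)
  have hinv : (fun g : adelicUnitary F E V Φ =>
      ((((frameUnitary F E σ hσδ hδ hd V b Φ hΦ₁ hΦ₂ g : UnitaryGroup.adelic F E σ n (gramMatrix F E V b Φ)) :
          GL (Fin n) (AdeleRing (𝓞 E) E))⁻¹ : GL (Fin n) (AdeleRing (𝓞 E) E)) : Matrix (Fin n) (Fin n) (AdeleRing (𝓞 E) E))) =
      fun g => ((gramMatrix F E V b Φ).map (algebraMap E (AdeleRing (𝓞 E) E)))⁻¹ *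
        ((((frameUnitary F E σ hσδ hδ hd V b Φ hΦ₁ hΦ₂ g : UnitaryGroup.adelic F E σ n (gramMatrix F E V b Φ)) :
            GL (Fin n) (AdeleRing (𝓞 E) E)) : Matrix (Fin n) (Fin n) (AdeleRing (𝓞 E) E)).map (conjAdele F E σ))ᵀ *
          (gramMatrix F E V b Φ).map (algebraMap E (AdeleRing (𝓞 E) E)) :=
    funext fun g => coe_inv_eq_of_mem_unitaryGroupOfForm hJA
      (frameUnitary F E σ hσδ hδ hd V b Φ hΦ₁ hΦ₂ g).2
  show Continuous fun g : adelicUnitary F E V Φ =>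
    ((((frameUnitary F E σ hσδ hδ hd V b Φ hΦ₁ hΦ₂ g : UnitaryGroup.adelic F E σ n (gramMatrix F E V b Φ)) :
        GL (Fin n) (AdeleRing (𝓞 E) E))⁻¹ : GL (Fin n) (AdeleRing (𝓞 E) E)) : Matrix (Fin n) (Fin n) (AdeleRing (𝓞 E) E))
  rw [hinv]
  exact (continuous_const.matrix_mul
    ((hcoe.matrix_map (AdeleRing.continuous_smul (F := F) σ)).matrix_transpose)).matrix_mul continuous_const

/-- **`frameUnitaryHomeomorph b : G(𝐀) ≃ₜ* U(J)(𝔸_F)`** — print's adelic unitary group of `(V, Φ)` with its topology of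
pointwise convergence on `W_𝐀` IS, as a topological group, the tree's `UnitaryGroup.adelic F E σ N (gramMatrix b Φ)`
(Gram matrix invertible, e.g. `φ` non-degenerate: `isUnit_det_gramMatrix`).
[cite: GelbartRogawski1991, §3.1 p. 454 L37–38; Prop. 3.1.1 p. 455 L1–2] -/
def frameUnitaryHomeomorph (hΦ₁ : ∀ (e : E) (x y : V), Φ (e • x) y = e * Φ x y)
    (hΦ₂ : ∀ (e : E) (x y : V), Φ x (e • y) = Φ x y * σ e) (hJ : IsUnit (gramMatrix F E V b Φ).det) :
    adelicUnitary F E V Φ ≃ₜ* UnitaryGroup.adelic F E σ n (gramMatrix F E V b Φ) where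
  toMulEquiv := frameUnitary F E σ hσδ hδ hd V b Φ hΦ₁ hΦ₂
  continuous_toFun := continuous_frameUnitary F E σ hσδ hδ hd V b Φ hΦ₁ hΦ₂ hJ
  continuous_invFun := continuous_frameUnitary_symm F E σ hσδ hδ hd V b Φ hΦ₁ hΦ₂

/-- `frameUnitaryHomeomorph` is `frameUnitary` on elements. [cite: GelbartRogawski1991, §3.1 p. 454 L37–38] -/
@[simp] theorem frameUnitaryHomeomorph_apply (hΦ₁ : ∀ (e : E) (x y : V), Φ (e • x) y = e * Φ x y)
    (hΦ₂ : ∀ (e : E) (x y : V), Φ x (e • y) = Φ x y * σ e) (hJ : IsUnit (gramMatrix F E V b Φ).det)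
    (g : adelicUnitary F E V Φ) :
    frameUnitaryHomeomorph F E σ hσδ hδ hd V b Φ hΦ₁ hΦ₂ hJ g = frameUnitary F E σ hσδ hδ hd V b Φ hΦ₁ hΦ₂ g :=
  rfl

end Topology

/-! ## §3. Rational points: `[g]_b ∈ U(J)(F)` iff `g = 1 ⊗ g₀` -/

section Rational

omit [NumberField F] [NumberField E] [Algebra.IsQuadraticExtension F E] [Module F V] [IsScalarTower F E V] in
/-- **the `E`-linear automorphism of `V` with matrix `γ ∈ GL_N(E)` in the basis `b`** (`Matrix.toLin b b`).
[cite: GelbartRogawski1991, Prop. 3.1.1 p. 455 L2] -/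
def linearEquivOfGL (γ : GL (Fin n) E) : V ≃ₗ[E] V :=
  LinearEquiv.ofLinear (Matrix.toLin b b (γ : Matrix (Fin n) (Fin n) E))
    (Matrix.toLin b b ((γ⁻¹ : GL (Fin n) E) : Matrix (Fin n) (Fin n) E))
    (by rw [← Matrix.toLin_mul, ← Units.val_mul, mul_inv_cancel, Units.val_one, Matrix.toLin_one])
    (by rw [← Matrix.toLin_mul, ← Units.val_mul, inv_mul_cancel, Units.val_one, Matrix.toLin_one])

omit [NumberField F] [NumberField E] [Algebra.IsQuadraticExtension F E] [Module F V] [IsScalarTower F E V] in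
/-- its matrix is `γ`. [cite: GelbartRogawski1991, Prop. 3.1.1 p. 455 L2] -/
@[simp] theorem toMatrix_linearEquivOfGL (γ : GL (Fin n) E) :
    LinearMap.toMatrix b b (linearEquivOfGL E V b γ : V →ₗ[E] V) = (γ : Matrix (Fin n) (Fin n) E) :=
  LinearMap.toMatrix_toLin b b _

omit [NumberField F] [NumberField E] [Algebra.IsQuadraticExtension F E] [Module F V] [IsScalarTower F E V] in
/-- coordinates: `[g₀ v]_b = [g₀]_b · [v]_b`. [cite: GelbartRogawski1991, Prop. 3.1.1 p. 455 L2] -/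
theorem repr_apply_eq_toMatrix_mulVec (g₀ : V →ₗ[E] V) (v : V) :
    (b.repr (g₀ v) : Fin n → E) = LinearMap.toMatrix b b g₀ *ᵥ (b.repr v : Fin n → E) :=
  (LinearMap.toMatrix_mulVec_repr b b g₀ v).symm

omit [NumberField F] [NumberField E] [Algebra.IsQuadraticExtension F E] [Module F V] [IsScalarTower F E V] in
/-- **the invertible matrix of an `E`-linear automorphism** `g₀` of `V` in the basis `b`.
[cite: GelbartRogawski1991, Prop. 3.1.1 p. 455 L2] -/
def toGL (g₀ : V ≃ₗ[E] V) : GL (Fin n) E :=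
  ⟨LinearMap.toMatrix b b (g₀ : V →ₗ[E] V), LinearMap.toMatrix b b (g₀.symm : V →ₗ[E] V),
    by rw [← LinearMap.toMatrix_comp b b b, LinearEquiv.comp_coe, LinearEquiv.symm_trans_self,
      LinearEquiv.refl_toLinearMap, LinearMap.toMatrix_id],
    by rw [← LinearMap.toMatrix_comp b b b, LinearEquiv.comp_coe, LinearEquiv.self_trans_symm,
      LinearEquiv.refl_toLinearMap, LinearMap.toMatrix_id]⟩

omit [NumberField F] [NumberField E] [Algebra.IsQuadraticExtension F E] [Module F V] [IsScalarTower F E V] in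
/-- its underlying matrix. [cite: GelbartRogawski1991, Prop. 3.1.1 p. 455 L2] -/
@[simp] theorem coe_toGL (g₀ : V ≃ₗ[E] V) :
    ((toGL E V b g₀ : GL (Fin n) E) : Matrix (Fin n) (Fin n) E) = LinearMap.toMatrix b b (g₀ : V →ₗ[E] V) :=
  rfl

omit [NumberField F] [NumberField E] [Algebra.IsQuadraticExtension F E] [IsScalarTower F E V] in
/-- **`g₀` preserves `Φ` iff `[g₀]_b ∈ U(J)(F)`** (`UnitaryGroup.rational F E σ N J = {γ ∈ GL_N(E) | ᵗ(σ γ) J γ = J}`).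
[cite: GelbartRogawski1991, §3.1 p. 454 L37–38; Prop. 3.1.1 p. 455 L2] -/
theorem forall_apply_eq_iff_toGL_mem (hΦ₁ : ∀ (e : E) (x y : V), Φ (e • x) y = e * Φ x y)
    (hΦ₂ : ∀ (e : E) (x y : V), Φ x (e • y) = Φ x y * σ e) (g₀ : V ≃ₗ[E] V) :
    (∀ x y : V, Φ (g₀ x) (g₀ y) = Φ x y) ↔ toGL E V b g₀ ∈ UnitaryGroup.rational F E σ n (gramMatrix F E V b Φ) := by
  unfold UnitaryGroup.rational
  rw [mem_unitaryGroupOfForm_iff, coe_toGL]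
  constructor
  · intro h
    refine matrix_eq_of_forall_hermForm_eq _ _ _ fun X Y => ?_
    obtain ⟨y, rfl⟩ : ∃ y : V, (b.repr y : Fin n → E) = X :=
      ⟨b.equivFun.symm X, by rw [← Module.Basis.equivFun_apply, LinearEquiv.apply_symm_apply]⟩
    obtain ⟨x, rfl⟩ : ∃ x : V, (b.repr x : Fin n → E) = Y :=
      ⟨b.equivFun.symm Y, by rw [← Module.Basis.equivFun_apply, LinearEquiv.apply_symm_apply]⟩
    rw [← repr_apply_eq_toMatrix_mulVec E V b, ← repr_apply_eq_toMatrix_mulVec E V b,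
      ← apply_eq_hermForm F E σ V b Φ hΦ₁ hΦ₂, ← apply_eq_hermForm F E σ V b Φ hΦ₁ hΦ₂]
    exact h x y
  · intro h x y
    rw [apply_eq_hermForm F E σ V b Φ hΦ₁ hΦ₂, apply_eq_hermForm F E σ V b Φ hΦ₁ hΦ₂,
      ← LinearEquiv.coe_coe g₀, repr_apply_eq_toMatrix_mulVec E V b, repr_apply_eq_toMatrix_mulVec E V b, hermForm_mulVec _ h]

omit [NumberField F] [Algebra.IsQuadraticExtension F E] [IsScalarTower F E V] in
/-- the underlying matrix of `toAdelic γ` is `γ ⊗ 1`. [cite: Mok2014, §1 Notation p. 5] -/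
theorem coe_toAdelic (γ : UnitaryGroup.rational F E σ n (gramMatrix F E V b Φ)) :
    ((UnitaryGroup.toAdelic F E σ n (gramMatrix F E V b Φ) γ : GL (Fin n) (AdeleRing (𝓞 E) E)) :
        Matrix (Fin n) (Fin n) (AdeleRing (𝓞 E) E)) =
      ((γ : GL (Fin n) E) : Matrix (Fin n) (Fin n) E).map (algebraMap E (AdeleRing (𝓞 E) E)) :=
  rfl

/-- **rational points correspond**: for `g ∈ G(𝐀)`, `[g]_b ∈ U(J)(F)` (the range of the tree's diagonal embedding
`UnitaryGroup.toAdelic : U(J)(F) →* U(J)(𝔸_F)`) iff print's "`g ∈ G(F)`" (`IsRationalPoint`: `g = 1 ⊗ g₀` for a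
`Φ`-isometry `g₀` of `V`). [cite: GelbartRogawski1991, Prop. 3.1.1 p. 455 L2] -/
theorem frameUnitary_mem_range_toAdelic_iff (hΦ₁ : ∀ (e : E) (x y : V), Φ (e • x) y = e * Φ x y)
    (hΦ₂ : ∀ (e : E) (x y : V), Φ x (e • y) = Φ x y * σ e) (g : adelicUnitary F E V Φ) :
    frameUnitary F E σ hσδ hδ hd V b Φ hΦ₁ hΦ₂ g ∈ (UnitaryGroup.toAdelic F E σ n (gramMatrix F E V b Φ)).range ↔
      IsRationalPoint F E V Φ (g : AdelicSpace F V ≃ₗ[AdeleRing (𝓞 F) F] AdelicSpace F V) := by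
  constructor
  · rintro ⟨γ, hγ⟩
    -- `g₀` := the automorphism with matrix `γ`; it preserves `Φ` and `1 ⊗ g₀` has the same frame matrix as `g`
    have hγmem : toGL E V b (linearEquivOfGL E V b (γ : GL (Fin n) E)) ∈ UnitaryGroup.rational F E σ n (gramMatrix F E V b Φ) := by
      have hval : toGL E V b (linearEquivOfGL E V b (γ : GL (Fin n) E)) = (γ : GL (Fin n) E) :=
        Units.ext (by rw [coe_toGL, toMatrix_linearEquivOfGL])
      rw [hval]
      exact γ.2
    refine ⟨linearEquivOfGL E V b (γ : GL (Fin n) E),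
      (forall_apply_eq_iff_toGL_mem F E σ V b Φ hΦ₁ hΦ₂ _).2 hγmem, ?_⟩
    -- the two elements of `GL_{𝐀 ⊗ E}(W_𝐀)` with the same matrix
    have hGL : frameGL F E σ hσδ hδ hd V b ⟨g, adelicUnitary_le_adelicGLE F E V Φ g.2⟩ =
        frameGL F E σ hσδ hδ hd V b ⟨((linearEquivOfGL E V b (γ : GL (Fin n) E)).restrictScalars F).baseChange F
          (AdeleRing (𝓞 F) F) V V, baseChange_mem_adelicGLE F E V _⟩ := by
      refine Units.ext ?_
      rw [coe_frameGL_baseChange, toMatrix_linearEquivOfGL, ← coe_toAdelic F E σ V b Φ, hγ, coe_frameUnitary]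
    have hg := congrArg Subtype.val ((frameGL F E σ hσδ hδ hd V b).injective hGL)
    simp only at hg
    rw [hg, LinearEquiv.coe_baseChange]
    rfl
  · rintro ⟨g₀, hg₀, hg⟩
    refine ⟨⟨toGL E V b g₀, (forall_apply_eq_iff_toGL_mem F E σ V b Φ hΦ₁ hΦ₂ g₀).1 hg₀⟩, Subtype.ext (Units.ext ?_)⟩
    have hgeq : (g : AdelicSpace F V ≃ₗ[AdeleRing (𝓞 F) F] AdelicSpace F V) =
        (g₀.restrictScalars F).baseChange F (AdeleRing (𝓞 F) F) V V :=
      LinearEquiv.toLinearMap_injective (by rw [hg, LinearEquiv.coe_baseChange]; rfl)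
    rw [coe_toAdelic, coe_toGL, coe_frameUnitary, ← coe_frameGL_baseChange F E σ hσδ hδ hd V b g₀]
    congr 2
    exact Subtype.ext hgeq.symm

end Rational

end Prop311

end Literature.NumberTheory.GelbartRogawski1991

end
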